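import Literature.NumberTheory.Automorphic.BlockUnipotentDomains
import Literature.NumberTheory.Automorphic.BlockUnipotentArchimedean
import Literature.NumberTheory.Automorphic.TestFunctionGLArchSlice
import Literature.Analysis.Calculus.IteratedDifferences
import HarnessLib

/-!
# The kernel of `R(η)` along a block unipotent radical: finite steps drop out, archimedean steps
are differences of a smooth slice, and the kernel lives on a fixed compact set
(Garrett, *Modern Analysis of Automorphic Forms by Example* (2018), §7.3, Claims 7.3.7–7.3.9,
7.3.11 and the Schwartz estimate, PDF pp. 336–342)

The kernel side of the basic estimate for cusp forms on a Siegel set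
(`GLnCuspidalSpectrum.norm_smoothedForm_le_of_isSiegelSetGL`, Garrett Thm. 7.3.10), in the
Poisson-free organisation of `Literature.Analysis.Calculus.IteratedDifferences`: for a test function
`η`, `θ` in a compact `Θ`, `g ∈ GL_n(𝔸_K)` and `a = posRealDiagonal b` in the Siegel cone, the
relevant function of `Y ∈ 𝔫_k(𝔸_K)` is the **kernel slice**
`E(Y) = η(θ · a⁻¹(1 + Y)a · g) = η(θ · (1 + blockConj b Y) · g)` (`siegelKernelSlice`), and the
cancellation against a cusp form is measured by its iterated differences `Δ_{X₁} ⋯ Δ_{X_q} E(0)`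
with steps in the scaled Tate domain `c · 𝓕₀` (`scaledBlockFundamentalDomain`). This file proves:

* `finIntegralBlock c` and `iterFwdDiff_siegelKernelSlice_eq_map_blockArchPart` — **finite parts of
  the steps drop out**: `E` is invariant under block-nilpotent translations with trivial
  archimedean part and `c`-divisible integral finite part (left invariance of `η` under a level,
  uniformly over `Θ`, the hypothesis `hcinv` produced by
  `IsTestFunctionGL.exists_int_forall_unipotentOfBlock_mul_eq`), and every step `X ∈ c · 𝓕₀`
  differs from its archimedean part `X_∞` by such a translation; so the differences may be taken
  along the `X_∞` (Garrett, PDF p. 340: the `H`-invariance at finite primes).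
* `siegelArchStep θ b`, `siegelKernelSlice_blockArchPart`,
  `iterFwdDiff_map_blockArchPart_siegelKernelSlice` — **archimedean steps are differences of the
  smooth slice**: `E(X_∞) = leftArchSlice η (θ g) (1 + θ_∞ (b-conjugate of X_∞) θ_∞⁻¹)`, an additive
  function of `X` inside a `C^∞` function on `M_n(K_∞)` (`TestFunctionGLArchSlice`), whence
  `Δ ⋯ Δ E(0) = Δ_{W₁} ⋯ Δ_{W_q} ψ(0)` with `W_i = siegelArchStep θ b X_i` and
  `‖W_i‖ ≤ ‖θ_∞‖‖θ_∞⁻¹‖ ρ ‖(X_i)_∞‖`, `ρ` the contraction factor of the cone on the block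
  (`norm_siegelArchStep_le`; Garrett, Lemma 7.3.12); and the smooth bound
  `‖Δ_{W₁} ⋯ Δ_{W_q} ψ(0)‖ ≤ B σ^q` (`norm_iterFwdDiff_translate_leftArchSlice_le`).
* `sublistSums`, `iterFwdDiff_siegelKernelSlice_eq_zero` — **the kernel lives on a fixed compact
  set**: if `g ∉ W⁻¹ Θ⁻¹ supp η`, where `W` contains the conjugates `a⁻¹(1 + ΣX)a` of the partial
  sums of the steps, all the differences vanish (Garrett, Claims 7.3.7–7.3.8).

Everything here is proved.

## References

* P. Garrett, *Modern Analysis of Automorphic Forms by Example* (2018), §7.3, Claims 7.3.7–7.3.9,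
  7.3.11, Lemma 7.3.12, PDF pp. 336–342 [Garrett2018].
-/

noncomputable section

open scoped MatrixGroups NNReal Classical Pointwise ContDiff
open NumberField NumberField.mixedEmbedding IsDedekindDomain Set
open Literature.Analysis.Calculus
open _root_.Topology

namespace Literature.NumberTheory.Automorphic

variable {n k : ℕ} {K : Type} [Field K] [NumberField K]

/-! ### The subgroup of finite, `c`-divisible integral steps -/

section FinSteps

/-- **Finite `c`-divisible integral block steps**: the additive subgroup of `𝔫_k(𝔸_K)` of the
`P` with trivial archimedean part whose finite entries are `c · y`, `y` an integral finite adele.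
Translations by these do not change a test function that is left invariant under the relevant
level (`IsTestFunctionGL.exists_int_forall_unipotentOfBlock_mul_eq`). [folklore] -/
def finIntegralBlock (c : 𝓞 K) : AddSubgroup (blockNilpotent n k (AdeleRing (𝓞 K) K)) where
  carrier := {P | (∀ i j, (((P : Matrix (Fin n) (Fin n) (AdeleRing (𝓞 K) K)) i j).1) = 0) ∧
    ∀ i j, ∃ y ∈ integralFiniteAdeles K,
      ((P : Matrix (Fin n) (Fin n) (AdeleRing (𝓞 K) K)) i j).2 =
        algebraMap (𝓞 K) (FiniteAdeleRing (𝓞 K) K) c * y}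
  zero_mem' := ⟨fun _ _ => rfl, fun _ _ => ⟨0, zero_mem _, by rw [mul_zero]; rfl⟩⟩
  add_mem' {P Q} hP hQ := by
    refine ⟨fun i j => ?_, fun i j => ?_⟩
    · change ((P : Matrix (Fin n) (Fin n) (AdeleRing (𝓞 K) K)) i j).1 +
        ((Q : Matrix (Fin n) (Fin n) (AdeleRing (𝓞 K) K)) i j).1 = 0
      rw [hP.1 i j, hQ.1 i j, add_zero]
    · obtain ⟨y, hy, hPy⟩ := hP.2 i j
      obtain ⟨y', hy', hQy⟩ := hQ.2 i j
      refine ⟨y + y', add_mem hy hy', ?_⟩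
      change ((P : Matrix (Fin n) (Fin n) (AdeleRing (𝓞 K) K)) i j).2 +
        ((Q : Matrix (Fin n) (Fin n) (AdeleRing (𝓞 K) K)) i j).2 = _
      rw [hPy, hQy, mul_add]
  neg_mem' {P} hP := by
    refine ⟨fun i j => ?_, fun i j => ?_⟩
    · change -(((P : Matrix (Fin n) (Fin n) (AdeleRing (𝓞 K) K)) i j).1) = 0
      rw [hP.1 i j, neg_zero]
    · obtain ⟨y, hy, hPy⟩ := hP.2 i j
      refine ⟨-y, neg_mem hy, ?_⟩
      change -(((P : Matrix (Fin n) (Fin n) (AdeleRing (𝓞 K) K)) i j).2) = _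
      rw [hPy, mul_neg]

/-- Membership in `finIntegralBlock c` (definitional). [folklore] -/
theorem mem_finIntegralBlock_iff {c : 𝓞 K} {P : blockNilpotent n k (AdeleRing (𝓞 K) K)} :
    P ∈ finIntegralBlock c ↔
      (∀ i j, (((P : Matrix (Fin n) (Fin n) (AdeleRing (𝓞 K) K)) i j).1) = 0) ∧
        ∀ i j, ∃ y ∈ integralFiniteAdeles K,
          ((P : Matrix (Fin n) (Fin n) (AdeleRing (𝓞 K) K)) i j).2 =
            algebraMap (𝓞 K) (FiniteAdeleRing (𝓞 K) K) c * y :=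
  Iff.rfl

/-- **The finite part of a step in `c · 𝓕₀` is a finite `c`-divisible integral step.** [folklore] -/
theorem blockFinPart_mem_finIntegralBlock {c : 𝓞 K} {X : blockNilpotent n k (AdeleRing (𝓞 K) K)}
    (hX : X ∈ scaledBlockFundamentalDomain n k K (c : K)) : blockFinPart X ∈ finIntegralBlock c := by
  have hX' : X ∈ (0 : blockNilpotent n k (AdeleRing (𝓞 K) K)) +ᵥ scaledBlockFundamentalDomain n k K (c : K) := by
    simpa using hX
  refine ⟨fun i j => fst_blockFinPart_apply X i j, fun i j => ?_⟩
  obtain ⟨y, hy, h⟩ := snd_apply_of_mem_vadd_scaledBlockFundamentalDomain c hX' i j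
  refine ⟨y, hy, ?_⟩
  rw [snd_blockFinPart_apply]
  simpa using h

/-- A step in `c · 𝓕₀` differs from its archimedean part by a finite `c`-divisible integral step.
[folklore] -/
theorem sub_blockArchPart_mem_finIntegralBlock {c : 𝓞 K} {X : blockNilpotent n k (AdeleRing (𝓞 K) K)}
    (hX : X ∈ scaledBlockFundamentalDomain n k K (c : K)) : X - blockArchPart X ∈ finIntegralBlock c := by
  have h : X - blockArchPart X = blockFinPart X := by
    rw [sub_eq_iff_eq_add', blockArchPart_add_blockFinPart]
  rw [h]
  exact blockFinPart_mem_finIntegralBlock hX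

end FinSteps

/-! ### The kernel slice -/

section Slice

variable (η : GL (Fin n) (AdeleRing (𝓞 K) K) → ℝ) (θ g : GL (Fin n) (AdeleRing (𝓞 K) K))
  (b : Fin n → ℝ≥0ˣ)

/-- **The kernel slice** `E(Y) = η(θ · (1 + blockConj b Y) · g) = η(θ · a⁻¹(1 + Y)a · g)`,
`a = posRealDiagonal b` (`posRealDiagonal_inv_mul_unipotentOfBlock_mul`): the kernel of `R(η)` at the
cusp point `a⁻¹ x₀`, read along the block unipotent radical `1 + 𝔫_k(𝔸_K)` (Garrett (2018), §7.3,
`φ(y⁻¹ exp(ν) x)`, PDF p. 336). [folklore] -/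
def siegelKernelSlice (Y : blockNilpotent n k (AdeleRing (𝓞 K) K)) : ℝ :=
  η (θ * unipotentOfBlock n k (AdeleRing (𝓞 K) K) (Multiplicative.ofAdd (blockConj b Y)) * g)

/-- Unfolding lemma. [folklore] -/
theorem siegelKernelSlice_apply (Y : blockNilpotent n k (AdeleRing (𝓞 K) K)) :
    siegelKernelSlice η θ g b Y =
      η (θ * unipotentOfBlock n k (AdeleRing (𝓞 K) K) (Multiplicative.ofAdd (blockConj b Y)) * g) :=
  rfl

variable {η θ g b}

/-- **Finite `c`-divisible integral steps do not change the kernel slice**, given the level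
invariance `hcinv` of `η` (the conclusion of
`IsTestFunctionGL.exists_int_forall_unipotentOfBlock_mul_eq` for `Θ` and the block `k`):
`E(Y + P) = E(Y)` — the conjugate `blockConj b P` again has trivial archimedean part and the same
finite entries, and `1 + blockConj b (Y + P) = (1 + blockConj b P)(1 + blockConj b Y)`.
[folklore] -/
theorem siegelKernelSlice_add_of_mem {Θ : Set (GL (Fin n) (AdeleRing (𝓞 K) K))} {c : 𝓞 K}
    (hcinv : ∀ θ ∈ Θ, ∀ P : blockNilpotent n k (AdeleRing (𝓞 K) K),
      (∀ i j, ((P : Matrix (Fin n) (Fin n) (AdeleRing (𝓞 K) K)) i j).1 = 0) →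
      (∀ i j, ∃ y ∈ integralFiniteAdeles K,
        ((P : Matrix (Fin n) (Fin n) (AdeleRing (𝓞 K) K)) i j).2 =
          algebraMap (𝓞 K) (FiniteAdeleRing (𝓞 K) K) c * y) →
      ∀ g, η (θ * unipotentOfBlock n k (AdeleRing (𝓞 K) K) (Multiplicative.ofAdd P) * g) = η (θ * g))
    (hθ : θ ∈ Θ) {P : blockNilpotent n k (AdeleRing (𝓞 K) K)} (hP : P ∈ finIntegralBlock c)
    (Y : blockNilpotent n k (AdeleRing (𝓞 K) K)) :
    siegelKernelSlice η θ g b (Y + P) = siegelKernelSlice η θ g b Y := by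
  rw [siegelKernelSlice_apply, siegelKernelSlice_apply, map_add, add_comm, ofAdd_add, map_mul]
  have h1 : ∀ i j, (((blockConj b P : blockNilpotent n k (AdeleRing (𝓞 K) K)) :
      Matrix (Fin n) (Fin n) (AdeleRing (𝓞 K) K)) i j).1 = 0 := fun i j => by
    rw [fst_blockConj_apply, hP.1 i j, mul_zero]
  have h2 : ∀ i j, ∃ y ∈ integralFiniteAdeles K,
      (((blockConj b P : blockNilpotent n k (AdeleRing (𝓞 K) K)) :
        Matrix (Fin n) (Fin n) (AdeleRing (𝓞 K) K)) i j).2 =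
        algebraMap (𝓞 K) (FiniteAdeleRing (𝓞 K) K) c * y := fun i j => by
    rw [snd_blockConj_apply]
    exact hP.2 i j
  have h := hcinv θ hθ (blockConj b P) h1 h2
    (unipotentOfBlock n k (AdeleRing (𝓞 K) K) (Multiplicative.ofAdd (blockConj b Y)) * g)
  simp only [mul_assoc] at h ⊢
  exact h

/-- **Finite parts of the steps drop out of the iterated differences**: with steps `Xᵢ` in the
scaled Tate domain `c · 𝓕₀`, `Δ_{X₁} ⋯ Δ_{X_q} E = Δ_{(X₁)_∞} ⋯ Δ_{(X_q)_∞} E`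
(`iterFwdDiff_eq_of_forall₂` with the subgroup `finIntegralBlock c`). [folklore] -/
theorem iterFwdDiff_siegelKernelSlice_eq_map_blockArchPart
    {Θ : Set (GL (Fin n) (AdeleRing (𝓞 K) K))} {c : 𝓞 K}
    (hcinv : ∀ θ ∈ Θ, ∀ P : blockNilpotent n k (AdeleRing (𝓞 K) K),
      (∀ i j, ((P : Matrix (Fin n) (Fin n) (AdeleRing (𝓞 K) K)) i j).1 = 0) →
      (∀ i j, ∃ y ∈ integralFiniteAdeles K,
        ((P : Matrix (Fin n) (Fin n) (AdeleRing (𝓞 K) K)) i j).2 =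
          algebraMap (𝓞 K) (FiniteAdeleRing (𝓞 K) K) c * y) →
      ∀ g, η (θ * unipotentOfBlock n k (AdeleRing (𝓞 K) K) (Multiplicative.ofAdd P) * g) = η (θ * g))
    (hθ : θ ∈ Θ) {l : List (blockNilpotent n k (AdeleRing (𝓞 K) K))}
    (hl : ∀ w ∈ l, w ∈ scaledBlockFundamentalDomain n k K (c : K)) :
    iterFwdDiff l (siegelKernelSlice η θ g b) =
      iterFwdDiff (l.map blockArchPart) (siegelKernelSlice η θ g b) := by
  refine iterFwdDiff_eq_of_forall₂ (finIntegralBlock c)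
    (fun P hP Y => siegelKernelSlice_add_of_mem hcinv hθ hP Y) ?_
  rw [List.forall₂_map_right_iff, List.forall₂_same]
  intro w hw
  exact sub_blockArchPart_mem_finIntegralBlock (hl w hw)

variable (θ b) in
/-- **The archimedean step map** `X ↦ θ_∞ · ((blockConj b X_∞)_∞) · θ_∞⁻¹`, an additive map
`𝔫_k(𝔸_K) →+ M_n(K_∞)`: the matrix by which the smooth slice is displaced when the kernel slice is
displaced by `X_∞`. [folklore] -/
def siegelArchStep : blockNilpotent n k (AdeleRing (𝓞 K) K) →+ Matrix (Fin n) (Fin n) (mixedSpace K) :=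
  (matrixConj n K (GLn.toMixed n K θ)).comp
    ((blockArchMatrix n k K).comp ((blockConj b).comp blockArchPart))

/-- Unfolding lemma for `siegelArchStep`. [folklore] -/
theorem siegelArchStep_apply (Z : blockNilpotent n k (AdeleRing (𝓞 K) K)) :
    siegelArchStep θ b Z =
      matrixConj n K (GLn.toMixed n K θ) (blockArchMatrix n k K (blockConj b (blockArchPart Z))) :=
  rfl

/-- **At an archimedean step the kernel slice is the smooth slice**:
`E(Z_∞) = leftArchSlice η (θ g) (1 + siegelArchStep θ b Z)` — `1 + blockConj b Z_∞` has trivial finite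
part, so it is the archimedean element `(1 + M, 1)` (`unipotentOfBlock_eq_ofInfinite`), and
`θ (U, 1) g = (θ_∞ U θ_∞⁻¹, 1) θ g` (`GLn.mul_ofInfinite_mul_inv`). [folklore] -/
theorem siegelKernelSlice_blockArchPart (Z : blockNilpotent n k (AdeleRing (𝓞 K) K)) :
    siegelKernelSlice η θ g b (blockArchPart Z) = leftArchSlice η (θ * g) (1 + siegelArchStep θ b Z) := by
  rw [siegelKernelSlice_apply]
  have hsnd : ∀ i j, ((((blockConj b (blockArchPart Z) : blockNilpotent n k (AdeleRing (𝓞 K) K)) :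
      Matrix (Fin n) (Fin n) (AdeleRing (𝓞 K) K)) i j).2) = 0 := fun i j => by
    rw [snd_blockConj_apply, snd_blockArchPart_apply]
  rw [unipotentOfBlock_eq_ofInfinite hsnd]
  set U : GL (Fin n) (mixedSpace K) := unitOneAddBlock (blockConj b (blockArchPart Z)) with hU
  have hθU : θ * GLn.ofInfinite n K U =
      GLn.ofInfinite n K (GLn.toMixed n K θ * U * (GLn.toMixed n K θ)⁻¹) * θ := by
    rw [← GLn.mul_ofInfinite_mul_inv θ U, inv_mul_cancel_right]
  rw [hθU, mul_assoc,
    ← leftArchSlice_coe (η := η) (x := θ * g) (GLn.toMixed n K θ * U * (GLn.toMixed n K θ)⁻¹),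
    coe_conj_unitOneAddBlock', siegelArchStep_apply]

/-- **Archimedean steps are differences of the smooth slice**:
`Δ_{(X₁)_∞} ⋯ Δ_{(X_q)_∞} E (0) = Δ_{W₁} ⋯ Δ_{W_q} ψ (0)` with `Wᵢ = siegelArchStep θ b Xᵢ` and
`ψ(M) = leftArchSlice η (θ g) (1 + M)` (`iterFwdDiff_comp_addMonoidHom`, twice). [folklore] -/
theorem iterFwdDiff_map_blockArchPart_siegelKernelSlice (l : List (blockNilpotent n k (AdeleRing (𝓞 K) K))) :
    iterFwdDiff (l.map blockArchPart) (siegelKernelSlice η θ g b) 0 =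
      iterFwdDiff (l.map (siegelArchStep θ b)) (fun M => leftArchSlice η (θ * g) (1 + M)) 0 := by
  have h1 := iterFwdDiff_comp_addMonoidHom (E := ℝ)
    (blockArchPart : blockNilpotent n k (AdeleRing (𝓞 K) K) →+ _) (siegelKernelSlice η θ g b) l 0
  rw [map_zero] at h1
  rw [← h1]
  have h2 : (siegelKernelSlice η θ g b ∘ (blockArchPart : blockNilpotent n k (AdeleRing (𝓞 K) K) →+ _)) =
      (fun M => leftArchSlice η (θ * g) (1 + M)) ∘ (siegelArchStep θ b) := by
    funext Z
    exact siegelKernelSlice_blockArchPart Z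
  rw [h2, iterFwdDiff_comp_addMonoidHom, map_zero]

end Slice

/-! ### Norm bounds -/

section Bounds

variable {η : GL (Fin n) (AdeleRing (𝓞 K) K) → ℝ} {θ g : GL (Fin n) (AdeleRing (𝓞 K) K)}
  {b : Fin n → ℝ≥0ˣ}

/-- The archimedean matrix only sees the archimedean part. [folklore] -/
theorem blockArchMatrix_blockArchPart (Z : blockNilpotent n k (AdeleRing (𝓞 K) K)) :
    blockArchMatrix n k K (blockArchPart Z) = blockArchMatrix n k K Z := by
  refine Matrix.ext fun i j => ?_
  rw [blockArchMatrix_apply, fst_blockArchPart_apply, blockArchMatrix_apply]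

set_option backward.isDefEq.respectTransparency false in
open scoped Matrix.Norms.Operator in
/-- **Size of the archimedean steps**: if `b_j / b_i ≤ ρ` on the block (`ρ ≥ 0`), then
`‖siegelArchStep θ b Z‖ ≤ ‖θ_∞‖ ‖θ_∞⁻¹‖ · ρ ‖Z_∞‖` (`norm_matrixConj_le`,
`norm_blockArchMatrix_blockConj_le`; Garrett (2018), Lemma 7.3.12, dual form).
[cite: Garrett2018, Lemma 7.3.12 (PDF pp. 341–342)] -/
theorem norm_siegelArchStep_le (θ : GL (Fin n) (AdeleRing (𝓞 K) K)) {b : Fin n → ℝ≥0ˣ} {ρ : ℝ}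
    (hρ : 0 ≤ ρ)
    (hb : ∀ i j : Fin n, (i : ℕ) < k → k ≤ (j : ℕ) → ((b j : ℝ≥0) : ℝ) / ((b i : ℝ≥0) : ℝ) ≤ ρ)
    (Z : blockNilpotent n k (AdeleRing (𝓞 K) K)) :
    ‖siegelArchStep θ b Z‖ ≤
      ‖(GLn.toMixed n K θ : Matrix (Fin n) (Fin n) (mixedSpace K))‖ *
        ‖(((GLn.toMixed n K θ)⁻¹ : GL (Fin n) (mixedSpace K)) : Matrix (Fin n) (Fin n) (mixedSpace K))‖ *
        (ρ * ‖blockArchMatrix n k K Z‖) := by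
  rw [siegelArchStep_apply]
  refine (norm_matrixConj_le _ _).trans ?_
  refine mul_le_mul_of_nonneg_left ?_ (mul_nonneg (norm_nonneg _) (norm_nonneg _))
  rw [← blockArchMatrix_blockArchPart Z]
  exact norm_blockArchMatrix_blockConj_le hρ hb (blockArchPart Z)

/-- Products of a list of reals in `[0, σ]` are at most `σ ^ length`. [folklore] -/
theorem List.prod_le_pow_length_of_forall_mem_Icc {l : List ℝ} {σ : ℝ}
    (h : ∀ x ∈ l, 0 ≤ x ∧ x ≤ σ) : l.prod ≤ σ ^ l.length := by
  induction l with
  | nil => simp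
  | cons a l ih =>
    rw [List.prod_cons, List.length_cons, pow_succ']
    have ha := h a List.mem_cons_self
    have hl : ∀ x ∈ l, 0 ≤ x ∧ x ≤ σ := fun x hx => h x (List.mem_cons_of_mem a hx)
    have hprod : 0 ≤ l.prod := List.prod_nonneg fun x hx => (hl x hx).1
    exact mul_le_mul ha.2 (ih hl) hprod (ha.1.trans ha.2)

set_option backward.isDefEq.respectTransparency false in
open scoped Matrix.Norms.Operator in
/-- **The smooth bound for the displaced slice.** If `‖D^q (leftArchSlice η x)‖ ≤ B` everywhere and
the `q` steps `Wᵢ` have `‖Wᵢ‖ ≤ σ`, then `‖Δ_{W₁} ⋯ Δ_{W_q} ψ (0)‖ ≤ B σ^q` for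
`ψ(M) = leftArchSlice η x (1 + M)` (`norm_iterFwdDiff_le_of_contDiff_infty`; the derivatives of `ψ`
are translates of those of the slice, Mathlib `iteratedFDeriv_comp_add_left`). [folklore] -/
theorem norm_iterFwdDiff_translate_leftArchSlice_le (hη : IsTestFunctionGL n K η)
    (x : GL (Fin n) (AdeleRing (𝓞 K) K)) {B : ℝ}
    {l : List (Matrix (Fin n) (Fin n) (mixedSpace K))}
    (hB : ∀ m, ‖iteratedFDeriv ℝ l.length (leftArchSlice η x) m‖ ≤ B) {σ : ℝ}
    (hσ : ∀ W ∈ l, ‖W‖ ≤ σ) :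
    ‖iterFwdDiff l (fun M => leftArchSlice η x (1 + M)) 0‖ ≤ B * σ ^ l.length := by
  have hψ : ContDiff ℝ ∞ (fun M : Matrix (Fin n) (Fin n) (mixedSpace K) => leftArchSlice η x (1 + M)) :=
    (hη.contDiff_leftArchSlice x).comp (contDiff_const.add contDiff_id)
  have hB' : ∀ m, ‖iteratedFDeriv ℝ l.length
      (fun M : Matrix (Fin n) (Fin n) (mixedSpace K) => leftArchSlice η x (1 + M)) m‖ ≤ B := fun m => by
    rw [iteratedFDeriv_comp_add_left]
    exact hB _
  have hB0 : 0 ≤ B := (norm_nonneg _).trans (hB 0)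
  refine (norm_iterFwdDiff_le_of_contDiff_infty hψ l hB' 0).trans ?_
  refine mul_le_mul_of_nonneg_left ?_ hB0
  have h := List.prod_le_pow_length_of_forall_mem_Icc (l := l.map (‖·‖)) (σ := σ) fun x hx => by
    obtain ⟨W, hW, rfl⟩ := List.mem_map.1 hx
    exact ⟨norm_nonneg _, hσ W hW⟩
  rwa [List.length_map] at h

end Bounds

/-! ### Partial sums of the steps and the support of the kernel -/

section Support

variable {V : Type*} [AddCommGroup V] [TopologicalSpace V] [IsTopologicalAddGroup V]

/-- **The sets of partial sums**: `sublistSums S 0 = {0}`,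
`sublistSums S (j+1) = sublistSums S j ∪ (S + sublistSums S j)`; the sums of the sublists of a
list of length `≤ j` with entries in `S` lie in `sublistSums S j`. [folklore] -/
def sublistSums (S : Set V) : ℕ → Set V
  | 0 => {0}
  | j + 1 => sublistSums S j ∪ (S + sublistSums S j)

omit [TopologicalSpace V] [IsTopologicalAddGroup V] in
/-- `sublistSums S 0 = {0}`. [folklore] -/
@[simp]
theorem sublistSums_zero (S : Set V) : sublistSums S 0 = {0} := rfl

omit [TopologicalSpace V] [IsTopologicalAddGroup V] in
/-- `sublistSums S (j+1) = sublistSums S j ∪ (S + sublistSums S j)`. [folklore] -/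
theorem sublistSums_succ (S : Set V) (j : ℕ) :
    sublistSums S (j + 1) = sublistSums S j ∪ (S + sublistSums S j) := rfl

omit [TopologicalSpace V] [IsTopologicalAddGroup V] in
/-- **Sums of sublists lie in `sublistSums`.** [folklore] -/
theorem sum_mem_sublistSums {S : Set V} {l s : List V} (hs : s.Sublist l) (hl : ∀ w ∈ l, w ∈ S) :
    s.sum ∈ sublistSums S l.length := by
  induction hs with
  | slnil => simp
  | cons a _ ih =>
    rw [List.length_cons, sublistSums_succ]
    exact Or.inl (ih fun w hw => hl w (List.mem_cons_of_mem a hw))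
  | cons_cons a _ ih =>
    rw [List.length_cons, sublistSums_succ, List.sum_cons]
    exact Or.inr ⟨a, hl a List.mem_cons_self, _, ih fun w hw => hl w (List.mem_cons_of_mem a hw), rfl⟩

/-- `sublistSums` of a compact set are compact. [folklore] -/
theorem isCompact_sublistSums {S : Set V} (hS : IsCompact S) : ∀ j, IsCompact (sublistSums S j)
  | 0 => by rw [sublistSums_zero]; exact isCompact_singleton
  | j + 1 => by
    rw [sublistSums_succ]
    exact (isCompact_sublistSums hS j).union (hS.add (isCompact_sublistSums hS j))

end Support

section Vanishing

variable {η : GL (Fin n) (AdeleRing (𝓞 K) K) → ℝ} {θ g : GL (Fin n) (AdeleRing (𝓞 K) K)}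
  {b : Fin n → ℝ≥0ˣ}

/-- **The kernel slice differences vanish off a fixed compact set.** If `W` contains the conjugates
`a⁻¹ (1 + Σ s) a` (`a = posRealDiagonal b`) of the sums of all sublists `s` of the steps, `θ ∈ Θ`, and
`g ∉ W⁻¹ · Θ⁻¹ · supp η`, then `Δ_{X₁} ⋯ Δ_{X_q} E (0) = 0`: every value `E(Σ s) = η(θ · a⁻¹(1 + Σ s)a · g)`
entering the difference vanishes, as `θ w g ∈ supp η` would force `g ∈ w⁻¹ θ⁻¹ supp η`
(`iterFwdDiff_eq_zero_of_forall_sublist`; Garrett (2018), Claims 7.3.7–7.3.8). [folklore] -/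
theorem iterFwdDiff_siegelKernelSlice_eq_zero {W Θ : Set (GL (Fin n) (AdeleRing (𝓞 K) K))}
    (hθ : θ ∈ Θ) {l : List (blockNilpotent n k (AdeleRing (𝓞 K) K))}
    (hW : ∀ s : List (blockNilpotent n k (AdeleRing (𝓞 K) K)), s.Sublist l →
      (posRealDiagonal n K b)⁻¹ *
          unipotentOfBlock n k (AdeleRing (𝓞 K) K) (Multiplicative.ofAdd s.sum) *
        posRealDiagonal n K b ∈ W)
    (hg : g ∉ W⁻¹ * Θ⁻¹ * tsupport η) :
    iterFwdDiff l (siegelKernelSlice η θ g b) 0 = 0 := by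
  refine iterFwdDiff_eq_zero_of_forall_sublist fun s hs => ?_
  rw [zero_add, siegelKernelSlice_apply, ← posRealDiagonal_inv_mul_unipotentOfBlock_mul b s.sum]
  set w := (posRealDiagonal n K b)⁻¹ *
      unipotentOfBlock n k (AdeleRing (𝓞 K) K) (Multiplicative.ofAdd s.sum) * posRealDiagonal n K b with hw
  by_contra hne
  apply hg
  have hsupp : θ * w * g ∈ tsupport η := subset_tsupport _ (Function.mem_support.2 hne)
  refine ⟨w⁻¹ * θ⁻¹, ⟨w⁻¹, Set.inv_mem_inv.2 (hW s hs), θ⁻¹, Set.inv_mem_inv.2 hθ, rfl⟩,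
    θ * w * g, hsupp, ?_⟩
  group

end Vanishing

end Literature.NumberTheory.Automorphic
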